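import Summits.Ventures.PercRepro.RankLevelSetPlaneLines
import Summits.Ventures.PercRepro.RLSCoreFlatsSmall

/-!
# PercRepro — `f(4) ≤ 10`: every rank-`4` set of the `e`-free core has at most `10` points (night-1, gen 3)

`proofs/NIGHT-1-C025-induction.md` §14.22, after mine-4's paper proof `data/mine-4/g18/F4-PROOF.md` §2, in the
`Set` form of `RankLevelSetPlaneSix` / `RankLevelSetPrimeCover` (`G ⊆ E` any set, coloops allowed). Ingredients:
(K1) planes `≤ 6`, lines `≤ 3` (`PlaneSix`, `LocalSparse`); (K2′) a `6`-point plane is prime (`gprime_of_six`);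
(K4) the prime-hyperplane lemma (`ncard_le_of_prime_cover`);

* (`RankLevelSetPlaneLines`) two points span a line, (K5) planes through a line, (K3′) the unique covering pair
  of a non-prime `5`-point plane;
* **`ncard_le_ten_of_eRk_le_four_of_free`** — **`f(4) ≤ 10`**: if `|G| ≥ 11` and `r(G) ≤ 4`, the cover `(H₁, H₂)`
  of a point `x` consists of two disjoint non-prime `5`-point planes (`6`-point or prime sides die by (K4)), `H₁`
  has its covering pair `(ℓ₁, ℓ₂)`; for every `y ∈ H₂` the cover of `y` meets `H₁` exactly in `(ℓ₁, ℓ₂)` (Step 2),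
  its traces `P_y, Q_y` on `R := G ∖ H₁` (`6` points) have `|P_y| ≤ 2`, `|Q_y| ≤ 3`, `P_y ∪ Q_y ⊇ R ∖ y`; distinct
  `y, y'` have disjoint `P`-traces (Step 3, by (K5) twice), so the five `2`-sets `P_y` sit disjointly in `R`:
  `10 ≤ 6` (Step 4);
* **`card_le_ten_of_core`** / **`core_flat_four_le_ten`** — the bridge to night-3's vocabulary: on a `Core` matroid
  every rank-`4` flat `F ∈ flatsQ M 4` has `F.card ≤ 10` (the hypothesis `h10` of night-2's `(7, 5)` composition,
  RULING (so)(4));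
* corollaries: the cover recursion now gives `f(5) ≤ 21`, `f(6) ≤ 43`, and the rank-`7` core has `≤ 87` elements
  (`ncard_le_twentyone_of_eRk_le_five_of_free`, …, `ncard_le_of_eRank_le_seven_of_free'`); the `q = 4` core
  threshold `32 / 16` of `RankLevelSetCoreGeneral.c025_core_four_of_flat_ten` becomes unconditional in
  `RankLevelSetCoreFour` (`c025_core_four_ten`).
Axioms: standard.
-/

open scoped Matroid

namespace PercRepro

namespace ThmN

variable {α : Type}

/-- **`f(4) ≤ 10`**: in a finite matroid in which every element has an `e`-free partition, every set `G ⊆ E` of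
rank `≤ 4` has at most `10` points. -/
theorem ncard_le_ten_of_eRk_le_four_of_free (M : Matroid α) [M.Finite]
    (hfree : ∀ e ∈ M.E, ∃ A ⊆ M.E \ {e}, e ∉ M.closure A ∧ e ∉ M.closure ((M.E \ {e}) \ A))
    {G : Set α} (hG : G ⊆ M.E) (hr : M.eRk G ≤ 4) : G.ncard ≤ 10 := by
  classical
  by_contra h10
  push Not at h10
  have hGfin : G.Finite := M.ground_finite.subset hG
  -- (i) proper `G`-closed sets have rank `≤ 3`; rank `≤ 3` ⇒ `≤ 6` points; rank `≤ 2` ⇒ `≤ 3` points;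
  --     `≥ 4` points ⇒ rank `≥ 3`
  have hproper : ∀ C : Set α, GClosed M G C → ∀ y ∈ G, y ∉ C → M.eRk C ≤ 3 := by
    intro C hC y hy hyC
    have h1 : M.eRk C < (4 : ℕ∞) := lt_of_lt_of_le (eRk_lt_of_gclosed_ssubset M hG hC hy hyC) hr
    have h4 : (4 : ℕ∞) = 3 + 1 := by norm_num
    rw [h4] at h1
    exact Order.le_of_lt_add_one h1
  have hsix : ∀ C : Set α, C ⊆ G → M.eRk C ≤ 3 → C.ncard ≤ 6 := fun C hC h =>
    ncard_le_six_of_eRk_le_three_of_free M hfree (hC.trans hG) h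
  have hthree : ∀ C : Set α, C ⊆ G → M.eRk C ≤ 2 → C.ncard ≤ 3 := by
    intro C hC h
    have := ncard_add_one_le_two_pow_of_eRk_le M (not_isLoop_of_free M hfree) hfree 2 C (hC.trans hG) h
    omega
  have hrk3 : ∀ C : Set α, C ⊆ G → 4 ≤ C.ncard → (3 : ℕ∞) ≤ M.eRk C := by
    intro C hC h4
    by_contra hlt
    push Not at hlt
    have h3 : (3 : ℕ∞) = 2 + 1 := by norm_num
    rw [h3] at hlt
    have := hthree C hC (Order.le_of_lt_add_one hlt)
    omega
  -- proper `G`-closed subsets of a `G`-closed set of rank `≤ 3` are lines: rank `≤ 2`, `≤ 3` points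
  have hprop : ∀ H : Set α, GClosed M G H → M.eRk H ≤ 3 → ∀ A : Set α, GClosed M G A → A ⊆ H → A ≠ H →
      M.eRk A ≤ 2 ∧ A.ncard ≤ 3 := by
    intro H hH hrH A hA hAH hne
    obtain ⟨y, hyH, hyA⟩ : ∃ y ∈ H, y ∉ A := by
      by_contra hall
      push Not at hall
      exact hne (Set.Subset.antisymm hAH hall)
    have hA' : GClosed M H A := ⟨hAH, fun z hz => hA.2 ⟨hz.1, hH.1 hz.2⟩⟩
    have h1 : M.eRk A < (3 : ℕ∞) :=
      lt_of_lt_of_le (eRk_lt_of_gclosed_ssubset M (hH.1.trans hG) hA' hyH hyA) hrH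
    have h3 : (3 : ℕ∞) = 2 + 1 := by norm_num
    rw [h3] at h1
    have hr2 : M.eRk A ≤ 2 := Order.le_of_lt_add_one h1
    exact ⟨hr2, hthree A (hAH.trans hH.1) hr2⟩
  -- (ii) (K4): a prime cover side with `≥ 4` points is impossible
  have hprime : ∀ x ∈ G, ∀ H₁ H₂ : Set α, GClosed M G H₁ → GClosed M G H₂ → x ∉ H₁ → x ∉ H₂ →
      G \ {x} ⊆ H₁ ∪ H₂ → GPrime M G H₁ → 4 ≤ H₁.ncard → H₁.ncard ≤ 6 → False := by
    intro x hx H₁ H₂ hH₁ hH₂ hxH₁ hxH₂ hcov hp h4 h6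
    have hrk : M.eRk G ≤ M.eRk H₁ + 1 := by
      calc M.eRk G ≤ 4 := hr
        _ = 3 + 1 := by norm_num
        _ ≤ M.eRk H₁ + 1 := add_le_add (hrk3 H₁ hH₁.1 h4) le_rfl
    have := ncard_le_of_prime_cover M hfree hG hx hH₁ hH₂ hxH₁ hxH₂ hcov hp hrk (r := 4) (by exact_mod_cast hr)
    omega
  -- (iii) every cover side has `≤ 5` points (a `6`-point side is prime by (K2′))
  have hside : ∀ x ∈ G, ∀ H₁ H₂ : Set α, GClosed M G H₁ → GClosed M G H₂ → x ∉ H₁ → x ∉ H₂ →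
      G \ {x} ⊆ H₁ ∪ H₂ → H₁.ncard ≤ 5 := by
    intro x hx H₁ H₂ hH₁ hH₂ hxH₁ hxH₂ hcov
    have hr3 := hproper H₁ hH₁ x hx hxH₁
    have h6 := hsix H₁ hH₁.1 hr3
    by_contra h5
    push Not at h5
    have h6' : H₁.ncard = 6 := by omega
    have hp : GPrime M G H₁ := gprime_of_self hH₁ (gprime_of_six M hfree (hH₁.1.trans hG) hr3 h6')
    exact hprime x hx H₁ H₂ hH₁ hH₂ hxH₁ hxH₂ hcov hp (by omega) h6
  -- (iv) the cover of a point `x`: two disjoint `5`-point planes, and `|G| = 11`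
  obtain ⟨x, hx⟩ : G.Nonempty := by
    rw [Set.nonempty_iff_ne_empty]
    intro h
    rw [h, Set.ncard_empty] at h10
    omega
  obtain ⟨H₁, H₂, hH₁, hH₂, hxH₁, hxH₂, hcov⟩ := exists_cover_of_free M hfree hG hx
  have hcov' : G \ {x} ⊆ H₂ ∪ H₁ := by rw [Set.union_comm]; exact hcov
  have hH₁5 := hside x hx H₁ H₂ hH₁ hH₂ hxH₁ hxH₂ hcov
  have hH₂5 := hside x hx H₂ H₁ hH₂ hH₁ hxH₂ hxH₁ hcov'
  have hH₁fin : H₁.Finite := hGfin.subset hH₁.1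
  have hH₂fin : H₂.Finite := hGfin.subset hH₂.1
  have hGx : (G \ {x}).ncard + 1 = G.ncard := Set.ncard_sdiff_singleton_add_one hx hGfin
  have hunion : (G \ {x}).ncard ≤ (H₁ ∪ H₂).ncard := Set.ncard_le_ncard hcov (hH₁fin.union hH₂fin)
  have hiu := Set.ncard_inter_add_ncard_union H₁ H₂ hH₁fin hH₂fin
  have hG11 : G.ncard = 11 := by omega
  have h5₁ : H₁.ncard = 5 := by omega
  have h5₂ : H₂.ncard = 5 := by omega
  have hdisj0 : (H₁ ∩ H₂).ncard = 0 := by omega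
  have hdisj : ∀ y, y ∈ H₁ → y ∈ H₂ → False := by
    intro y hy₁ hy₂
    have hne : (H₁ ∩ H₂).Nonempty := ⟨y, hy₁, hy₂⟩
    rw [Set.nonempty_iff_ne_empty] at hne
    exact hne ((Set.ncard_eq_zero (hH₁fin.subset Set.inter_subset_left)).1 hdisj0)
  have hrH₁ : M.eRk H₁ ≤ 3 := hproper H₁ hH₁ x hx hxH₁
  have hrH₂ : M.eRk H₂ ≤ 3 := hproper H₂ hH₂ x hx hxH₂
  -- (v) `H₁` is not prime (K4 with `5 ≥ 4`): its covering pair `(ℓ₁, ℓ₂)`, `ℓ₁` a `3`-point line, `ℓ₂ ⊇ H₁ ∖ ℓ₁`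
  have hnp : ¬ GPrime M G H₁ := fun hp => hprime x hx H₁ H₂ hH₁ hH₂ hxH₁ hxH₂ hcov hp (by omega) (by omega)
  obtain ⟨ℓ₁, ℓ₂, hℓ₁, hℓ₂, hℓ₁H, hℓ₂H, hℓcov, hℓ₁ne, hℓ₂ne, hℓ₁3⟩ : ∃ ℓ₁ ℓ₂ : Set α, GClosed M G ℓ₁ ∧
      GClosed M G ℓ₂ ∧ ℓ₁ ⊆ H₁ ∧ ℓ₂ ⊆ H₁ ∧ H₁ ⊆ ℓ₁ ∪ ℓ₂ ∧ ℓ₁ ≠ H₁ ∧ ℓ₂ ≠ H₁ ∧ ℓ₁.ncard = 3 := by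
    unfold GPrime at hnp
    push Not at hnp
    obtain ⟨A, B, hA, hB, hAH, hBH, hcovAB, hAne, hBne⟩ := hnp
    obtain ⟨_, hA3⟩ := hprop H₁ hH₁ hrH₁ A hA hAH hAne
    obtain ⟨_, hB3⟩ := hprop H₁ hH₁ hrH₁ B hB hBH hBne
    have h5 : 5 ≤ A.ncard + B.ncard := by
      calc 5 = H₁.ncard := h5₁.symm
        _ ≤ (A ∪ B).ncard := Set.ncard_le_ncard hcovAB ((hH₁fin.subset hAH).union (hH₁fin.subset hBH))
        _ ≤ A.ncard + B.ncard := Set.ncard_union_le _ _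
    rcases Nat.lt_or_ge A.ncard 3 with hlt | hge
    · exact ⟨B, A, hB, hA, hBH, hAH, by rw [Set.union_comm]; exact hcovAB, hBne, hAne, by omega⟩
    · exact ⟨A, B, hA, hB, hAH, hBH, hcovAB, hAne, hBne, by omega⟩
  obtain ⟨hr₁, _⟩ := hprop H₁ hH₁ hrH₁ ℓ₁ hℓ₁ hℓ₁H hℓ₁ne
  obtain ⟨hr₂, hℓ₂3⟩ := hprop H₁ hH₁ hrH₁ ℓ₂ hℓ₂ hℓ₂H hℓ₂ne
  have hHℓ : H₁ \ ℓ₁ ⊆ ℓ₂ := by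
    intro y hy
    rcases hℓcov hy.1 with h | h
    · exact absurd h hy.2
    · exact h
  have hHℓ2 : (H₁ \ ℓ₁).ncard + ℓ₁.ncard = H₁.ncard := Set.ncard_sdiff_add_ncard_of_subset hℓ₁H hH₁fin
  have hℓ₂2 : 2 ≤ ℓ₂.ncard := by
    have := Set.ncard_le_ncard hHℓ (hH₁fin.subset hℓ₂H)
    omega
  -- (vi) `R := G ∖ H₁`, six points, containing `H₂` and `x`
  set R := G \ H₁ with hR
  have hRfin : R.Finite := hGfin.subset Set.sdiff_subset
  have hR6 : R.ncard = 6 := by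
    have : R.ncard + H₁.ncard = G.ncard := Set.ncard_sdiff_add_ncard_of_subset hH₁.1 hGfin
    omega
  have hH₂R : H₂ ⊆ R := fun y hy => ⟨hH₂.1 hy, fun h => hdisj y h hy⟩
  -- (vii) Step 2: for every `y ∈ H₂` a cover `(G₁ y, G₂ y)` of `y` meeting `H₁` exactly in `(ℓ₁, ℓ₂)`, `≤ 5` points
  have hcovy : ∀ y : α, ∃ G₁ G₂ : Set α, y ∈ H₂ → (GClosed M G G₁ ∧ GClosed M G G₂ ∧ y ∉ G₁ ∧ y ∉ G₂ ∧
      G \ {y} ⊆ G₁ ∪ G₂ ∧ G₁ ∩ H₁ = ℓ₁ ∧ G₂ ∩ H₁ = ℓ₂ ∧ G₁.ncard ≤ 5 ∧ G₂.ncard ≤ 5) := by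
    intro y
    by_cases hy : y ∈ H₂
    · have hyG : y ∈ G := hH₂.1 hy
      obtain ⟨G₁, G₂, hG₁, hG₂, hyG₁, hyG₂, hcy⟩ := exists_cover_of_free M hfree hG hyG
      have hcy' : G \ {y} ⊆ G₂ ∪ G₁ := by rw [Set.union_comm]; exact hcy
      -- Step 2(a): no side of the cover of `y` contains `H₁`
      have htrace : ∀ C D : Set α, GClosed M G C → GClosed M G D → y ∉ C → y ∉ D → G \ {y} ⊆ C ∪ D →
          C ∩ H₁ ≠ H₁ := by
        intro C D hC hD hyC hyD hcovCD heq
        have hH₁C : H₁ ⊆ C := by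
          intro z hz
          have : z ∈ C ∩ H₁ := by rw [heq]; exact hz
          exact this.1
        -- `C = H₁`
        have hCH₁ : C ⊆ H₁ := by
          have hcl : C ⊆ M.closure H₁ := subset_closure_of_eRk_le M hH₁C (hC.1.trans hG)
            (hGfin.subset hC.1) ((hproper C hC y hyG hyC).trans (hrk3 H₁ hH₁.1 (by omega)))
          exact fun z hz => hH₁.2 ⟨hcl hz, hC.1 hz⟩
        -- so `D ⊇ H₂ ∖ {y}`: `D ∩ H₂` is a proper `G`-closed subset of `H₂` with `≥ 4` points
        have hsub : H₂ \ {y} ⊆ D ∩ H₂ := by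
          intro z hz
          rcases hcovCD ⟨hH₂.1 hz.1, hz.2⟩ with h | h
          · exact absurd hz.1 (fun h2 => hdisj z (hCH₁ h) h2)
          · exact ⟨h, hz.1⟩
        have hDH₂ : D ∩ H₂ ≠ H₂ := by
          intro h
          have : y ∈ D ∩ H₂ := by rw [h]; exact hy
          exact hyD this.1
        obtain ⟨_, h3⟩ := hprop H₂ hH₂ hrH₂ (D ∩ H₂) (hD.inter hH₂) Set.inter_subset_right hDH₂
        have h4 : (H₂ \ {y}).ncard + 1 = H₂.ncard := Set.ncard_sdiff_singleton_add_one hy hH₂fin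
        have := Set.ncard_le_ncard hsub (hH₂fin.subset Set.inter_subset_right)
        omega
      have htr₁ := htrace G₁ G₂ hG₁ hG₂ hyG₁ hyG₂ hcy
      have htr₂ := htrace G₂ G₁ hG₂ hG₁ hyG₂ hyG₁ hcy'
      obtain ⟨hr₁', _⟩ := hprop H₁ hH₁ hrH₁ (G₁ ∩ H₁) (hG₁.inter hH₁) Set.inter_subset_right htr₁
      obtain ⟨hr₂', _⟩ := hprop H₁ hH₁ hrH₁ (G₂ ∩ H₁) (hG₂.inter hH₁) Set.inter_subset_right htr₂
      -- Step 2(b): the traces cover `H₁`, so (K3′) normalises them to `(ℓ₁, ℓ₂)`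
      have hcovH : H₁ ⊆ (G₁ ∩ H₁) ∪ (G₂ ∩ H₁) := by
        intro z hz
        have hzy : z ∉ ({y} : Set α) := by
          intro h
          rw [Set.mem_singleton_iff] at h
          exact hdisj z hz (h ▸ hy)
        rcases hcy ⟨hH₁.1 hz, hzy⟩ with h | h
        · exact Or.inl ⟨h, hz⟩
        · exact Or.inr ⟨h, hz⟩
      -- Step 2(c): both sides have `≤ 5` points
      have h5₁' := hside y hyG G₁ G₂ hG₁ hG₂ hyG₁ hyG₂ hcy
      have h5₂' := hside y hyG G₂ G₁ hG₂ hG₁ hyG₂ hyG₁ hcy'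
      rcases cover_pair_eq M hfree hG hH₁.1 h5₁ hℓ₁ hℓ₁H hℓ₁3 hr₁ hℓ₂ hr₂ hHℓ (hG₁.inter hH₁) (hG₂.inter hH₁)
          hr₁' hr₂' hcovH with ⟨e₁, e₂⟩ | ⟨e₁, e₂⟩
      · exact ⟨G₁, G₂, fun _ => ⟨hG₁, hG₂, hyG₁, hyG₂, hcy, e₁, e₂, h5₁', h5₂'⟩⟩
      · exact ⟨G₂, G₁, fun _ => ⟨hG₂, hG₁, hyG₂, hyG₁, hcy', e₂, e₁, h5₂', h5₁'⟩⟩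
    · exact ⟨∅, ∅, fun h => absurd h hy⟩
  choose G₁ G₂ hGy using hcovy
  -- (viii) Step 2(d): the traces `P y := G₁ y ∖ H₁`, `Q y := G₂ y ∖ H₁` on `R`
  have hP : ∀ y ∈ H₂, G₁ y \ H₁ ⊆ R \ {y} ∧ (G₁ y \ H₁).ncard ≤ 2 ∧ 2 ≤ (G₁ y \ H₁).ncard ∧
      (G₂ y \ H₁).ncard ≤ 3 ∧ R \ {y} ⊆ (G₁ y \ H₁) ∪ (G₂ y \ H₁) := by
    intro y hy
    obtain ⟨hG₁y, hG₂y, hyG₁, hyG₂, hcy, e₁, e₂, h5₁', h5₂'⟩ := hGy y hy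
    have hPsub : G₁ y \ H₁ ⊆ R \ {y} := fun z hz =>
      ⟨⟨hG₁y.1 hz.1, hz.2⟩, fun h => hyG₁ ((Set.mem_singleton_iff.1 h) ▸ hz.1)⟩
    have hPc : (G₁ y ∩ H₁).ncard + (G₁ y \ H₁).ncard = (G₁ y).ncard :=
      Set.ncard_inter_add_ncard_sdiff_eq_ncard _ _ (hGfin.subset hG₁y.1)
    have hQc : (G₂ y ∩ H₁).ncard + (G₂ y \ H₁).ncard = (G₂ y).ncard :=
      Set.ncard_inter_add_ncard_sdiff_eq_ncard _ _ (hGfin.subset hG₂y.1)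
    rw [e₁, hℓ₁3] at hPc
    rw [e₂] at hQc
    have hcovR : R \ {y} ⊆ (G₁ y \ H₁) ∪ (G₂ y \ H₁) := by
      intro z hz
      rcases hcy ⟨hz.1.1, hz.2⟩ with h | h
      · exact Or.inl ⟨h, hz.1.2⟩
      · exact Or.inr ⟨h, hz.1.2⟩
    have hRy : (R \ {y}).ncard + 1 = R.ncard := Set.ncard_sdiff_singleton_add_one (hH₂R hy) hRfin
    have hle : (R \ {y}).ncard ≤ (G₁ y \ H₁).ncard + (G₂ y \ H₁).ncard :=
      (Set.ncard_le_ncard hcovR ((hGfin.subset (Set.sdiff_subset.trans hG₁y.1)).union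
        (hGfin.subset (Set.sdiff_subset.trans hG₂y.1)))).trans (Set.ncard_union_le _ _)
    exact ⟨hPsub, by omega, by omega, by omega, hcovR⟩
  -- (ix) Step 3: distinct points of `H₂` have disjoint `P`-traces
  have hdisjP : ∀ y ∈ H₂, ∀ y' ∈ H₂, y ≠ y' → ∀ z, z ∈ G₁ y \ H₁ → z ∈ G₁ y' \ H₁ → False := by
    intro y hy y' hy' hne z hz hz'
    obtain ⟨hG₁y, hG₂y, hyG₁, hyG₂, hcy, e₁, e₂, -, -⟩ := hGy y hy
    obtain ⟨hG₁y', hG₂y', hyG₁', hyG₂', hcy', e₁', e₂', -, -⟩ := hGy y' hy'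
    obtain ⟨hPsub, hP2, -, -, hcovR⟩ := hP y hy
    obtain ⟨-, -, -, -, hcovR'⟩ := hP y' hy'
    have hℓ₁y : ℓ₁ ⊆ G₁ y := fun w hw => (show w ∈ G₁ y ∩ H₁ by rw [e₁]; exact hw).1
    have hℓ₁y' : ℓ₁ ⊆ G₁ y' := fun w hw => (show w ∈ G₁ y' ∩ H₁ by rw [e₁']; exact hw).1
    have hℓ₂y : ℓ₂ ⊆ G₂ y := fun w hw => (show w ∈ G₂ y ∩ H₁ by rw [e₂]; exact hw).1
    have hℓ₂y' : ℓ₂ ⊆ G₂ y' := fun w hw => (show w ∈ G₂ y' ∩ H₁ by rw [e₂']; exact hw).1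
    have hr₁y : M.eRk (G₁ y) ≤ 3 := hproper _ hG₁y y (hH₂.1 hy) hyG₁
    have hr₁y' : M.eRk (G₁ y') ≤ 3 := hproper _ hG₁y' y' (hH₂.1 hy') hyG₁'
    have hr₂y : M.eRk (G₂ y) ≤ 3 := hproper _ hG₂y y (hH₂.1 hy) hyG₂
    -- (K5) with `ℓ₁`: the two planes through `ℓ₁` and `z` coincide
    have hzℓ : z ∉ ℓ₁ := fun h => hz.2 (hℓ₁H h)
    have heq₁ : G₁ y = G₁ y' := Set.Subset.antisymm
      (gclosed_subset_of_line_of_mem M hfree hG hℓ₁ (by omega) hG₁y hG₁y' hr₁y hℓ₁y hℓ₁y' hz.1 hz'.1 hzℓ)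
      (gclosed_subset_of_line_of_mem M hfree hG hℓ₁ (by omega) hG₁y' hG₁y hr₁y' hℓ₁y' hℓ₁y hz'.1 hz.1 hzℓ)
    -- a point `z'` of `R` outside `P = G₁ y ∖ H₁` and different from `y, y'`
    have hXsub : (G₁ y \ H₁) ∪ {y, y'} ⊆ R := by
      refine Set.union_subset (hPsub.trans Set.sdiff_subset) ?_
      intro w hw
      rcases Set.mem_insert_iff.1 hw with h | h
      · rw [h]; exact hH₂R hy
      · rw [Set.mem_singleton_iff.1 h]; exact hH₂R hy'
    have hXcard : ((G₁ y \ H₁) ∪ {y, y'}).ncard ≤ 4 := by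
      have h1 := Set.ncard_union_le (G₁ y \ H₁) ({y, y'} : Set α)
      have h2 : ({y, y'} : Set α).ncard = 2 := Set.ncard_pair hne
      omega
    have hrest := Set.ncard_le_ncard_sdiff_add_ncard R ((G₁ y \ H₁) ∪ {y, y'}) (hRfin.subset hXsub)
    obtain ⟨z', hz'R, hz'X⟩ : (R \ ((G₁ y \ H₁) ∪ {y, y'})).Nonempty :=
      Set.nonempty_of_ncard_ne_zero (by omega)
    have hz'y : z' ≠ y := fun h => hz'X (Or.inr (by rw [h]; exact Set.mem_insert y {y'}))
    have hz'y' : z' ≠ y' := fun h => hz'X (Or.inr (by rw [h]; exact Set.mem_insert_of_mem y rfl))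
    have hz'P : z' ∉ G₁ y \ H₁ := fun h => hz'X (Or.inl h)
    have hz'Q : z' ∈ G₂ y \ H₁ := by
      rcases hcovR ⟨hz'R, fun h => hz'y (Set.mem_singleton_iff.1 h)⟩ with h | h
      · exact absurd h hz'P
      · exact h
    have hz'Q' : z' ∈ G₂ y' \ H₁ := by
      rcases hcovR' ⟨hz'R, fun h => hz'y' (Set.mem_singleton_iff.1 h)⟩ with h | h
      · exact absurd h (by rw [heq₁] at hz'P; exact hz'P)
      · exact h
    -- (K5) with `ℓ₂`: `G₂ y ⊆ G₂ y'`, but `y' ∈ G₂ y ∖ H₁` and `y' ∉ G₂ y'`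
    have hz'ℓ : z' ∉ ℓ₂ := fun h => hz'Q.2 (hℓ₂H h)
    have heq₂ : G₂ y ⊆ G₂ y' :=
      gclosed_subset_of_line_of_mem M hfree hG hℓ₂ hℓ₂2 hG₂y hG₂y' hr₂y hℓ₂y hℓ₂y' hz'Q.1 hz'Q'.1 hz'ℓ
    have hy'Q : y' ∈ G₂ y \ H₁ := by
      rcases hcovR ⟨hH₂R hy', fun h => hne (Set.mem_singleton_iff.1 h).symm⟩ with h | h
      · exact absurd h (by rw [heq₁]; exact fun h' => hyG₁' h'.1)
      · exact h
    exact hyG₂' (heq₂ hy'Q.1)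
  -- (x) Step 4: five pairwise disjoint `2`-sets inside the `6`-point `R`
  set s : Finset α := hH₂fin.toFinset with hs
  set t : α → Finset α := fun y => hRfin.toFinset.filter (fun z => z ∈ G₁ y \ H₁) with ht
  have hmem : ∀ y, y ∈ s ↔ y ∈ H₂ := fun y => by rw [hs]; exact Set.Finite.mem_toFinset hH₂fin
  have hmemt : ∀ y z, z ∈ t y ↔ z ∈ R ∧ z ∈ G₁ y \ H₁ := fun y z => by
    rw [ht]; simp only [Finset.mem_filter, Set.Finite.mem_toFinset]
  have hs5 : s.card = 5 := by rw [hs, ← Set.ncard_eq_toFinset_card H₂ hH₂fin]; exact h5₂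
  have htc : ∀ y ∈ s, (t y).card = 2 := by
    intro y hy
    obtain ⟨hPsub, hP2, hP2', -, -⟩ := hP y ((hmem y).1 hy)
    have hcoe : ((t y : Finset α) : Set α) = G₁ y \ H₁ := by
      ext z
      rw [Finset.mem_coe, hmemt]
      exact ⟨fun h => h.2, fun h => ⟨(hPsub h).1, h⟩⟩
    rw [← Set.ncard_coe_finset, hcoe]
    omega
  have hpd : (s : Set α).PairwiseDisjoint t := by
    intro y hy y' hy' hne
    show Disjoint (t y) (t y')
    rw [Finset.disjoint_left]
    intro z hz hz'
    exact hdisjP y ((hmem y).1 (Finset.mem_coe.1 hy)) y' ((hmem y').1 (Finset.mem_coe.1 hy')) hne z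
      ((hmemt y z).1 hz).2 ((hmemt y' z).1 hz').2
  have hbi : (s.biUnion t).card = ∑ y ∈ s, (t y).card := Finset.card_biUnion hpd
  have hsum : ∑ y ∈ s, (t y).card = 10 := by
    rw [Finset.sum_congr rfl htc, Finset.sum_const, hs5]
    rfl
  have hsub : s.biUnion t ⊆ hRfin.toFinset := by
    intro z hz
    obtain ⟨y, -, hz⟩ := Finset.mem_biUnion.1 hz
    exact (Set.Finite.mem_toFinset hRfin).2 ((hmemt y z).1 hz).1
  have h6 : hRfin.toFinset.card = 6 := by rw [← Set.ncard_eq_toFinset_card R hRfin]; exact hR6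
  have := Finset.card_le_card hsub
  omega

/-- **`card_le_ten_of_core` (RULING (so)(4))**: on a core matroid (`NightThree.Core M p`: simple, rank `p`,
coloop-free, every element with an `e`-free partition) every rank-`4` flat `F ∈ flatsQ M 4` has at most `10`
points — `f(4) ≤ 10`, the named input of night-2's `(7, 5)` composition. -/
theorem card_le_ten_of_core {M : Matroid α} [M.Finite] {p : ℕ} (hc : NightThree.Core M p)
    {F : Finset α} (hF : F ∈ PerFlat.flatsQ M 4) : F.card ≤ 10 := by
  obtain ⟨hFE, _, hrk⟩ := PerFlat.mem_flatsQ.1 hF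
  have hFE' : (F : Set α) ⊆ M.E := by rw [← ThmH.coe_gr M]; exact Finset.coe_subset.2 hFE
  have := ncard_le_ten_of_eRk_le_four_of_free M hc.2.2.2 hFE' (le_of_eq hrk)
  rwa [Set.ncard_coe_finset] at this

/-- `f(4) ≤ 10` on the core in the binder form of night-2's hypothesis `h10`
(`Night2SevenFiveCore.rls_seven_five_of_core_of_ten`). -/
theorem core_flat_four_le_ten :
    ∀ {β : Type} [DecidableEq β] (M : Matroid β) [M.Finite] {p : ℕ}, NightThree.Core M p →
      ∀ F ∈ PerFlat.flatsQ M 4, F.card ≤ 10 := by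
  intro β _ M _ p hc F hF
  exact card_le_ten_of_core hc hF

/-- Rank-`5` sets of the `e`-free core have at most `21` points (`f(5) ≤ 2·f(4) + 1`). -/
theorem ncard_le_twentyone_of_eRk_le_five_of_free (M : Matroid α) [M.Finite]
    (hfree : ∀ e ∈ M.E, ∃ A ⊆ M.E \ {e}, e ∉ M.closure A ∧ e ∉ M.closure ((M.E \ {e}) \ A))
    {F : Set α} (hF : F ⊆ M.E) (hr : M.eRk F ≤ 5) : F.ncard ≤ 21 :=
  ncard_le_two_mul_add_one_of_free M hfree (k := 4) (B := 10)
    (fun _ hY hrY => ncard_le_ten_of_eRk_le_four_of_free M hfree hY hrY) F hF hr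

/-- Rank-`6` sets of the `e`-free core have at most `43` points. -/
theorem ncard_le_fortythree_of_eRk_le_six_of_free (M : Matroid α) [M.Finite]
    (hfree : ∀ e ∈ M.E, ∃ A ⊆ M.E \ {e}, e ∉ M.closure A ∧ e ∉ M.closure ((M.E \ {e}) \ A))
    {F : Set α} (hF : F ⊆ M.E) (hr : M.eRk F ≤ 6) : F.ncard ≤ 43 :=
  ncard_le_two_mul_add_one_of_free M hfree (k := 5) (B := 21)
    (fun _ hY hrY => ncard_le_twentyone_of_eRk_le_five_of_free M hfree hY hrY) F hF hr

/-- **The rank-`7` `e`-free core lives on at most `87` elements** (sharpening `111`). -/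
theorem ncard_le_of_eRank_le_seven_of_free' (M : Matroid α) [M.Finite]
    (hfree : ∀ e ∈ M.E, ∃ A ⊆ M.E \ {e}, e ∉ M.closure A ∧ e ∉ M.closure ((M.E \ {e}) \ A))
    (hR : M.eRank ≤ 7) : M.E.ncard ≤ 87 :=
  ncard_le_two_mul_add_one_of_free M hfree (k := 6) (B := 43)
    (fun _ hY hrY => ncard_le_fortythree_of_eRk_le_six_of_free M hfree hY hrY) M.E subset_rfl
    (by rw [← M.eRank_def]; exact hR)

end ThmN

end PercRepro
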